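import Summits.QuantumFields.YangMills.Theorems.LuscherReductionOneSiteLevelsKacAssemblyPrep

/-!
# INNER, flat lane (layer III): the high-mode bound for the remainder (III.10)

Support module of crux `OneSiteLevels` (route `LuscherReduction`, item stmt-QuantumFields-20007), FLAT lane of the
registered v12 stub `stub_flatKacAL1` (STUB-PLAN rev 3 row III.10, mass-defect form).

For an AL1 eigenfamily `f_0,…,f_m` whose next level is far above the target window, `physLevel (m+2) ≥ E + 96κ² + 3`,
and the remainder `r = g − Σ⟨g,f_j⟩f_j` of a datum `g` of `FlatKacFormBound` (support in `‖x‖ ≤ κ/√t`):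
`kacForm t r ≥ (E + 2) ∫ r² − D₀ · t · Σ c_j²` for `0 < t ≤ t₀` (`kacForm_remainder_ge`).
Ingredients: `u = P_{t/2} r ∈ IsKacFn` (H6d), the mass defect `t·flatJump = ‖r‖² − ‖u‖²`, the reverse-Poincaré energy bound
(H6b), the potential transfer at `s = t/2` with the INSIDE/OUTSIDE split `t‖x‖²r² ≤ κ²r² + t‖x‖²F²` (trap 4), the
almost-orthogonality budget (H6e) and the min–max bound H3‴ at level `m+1`.

Real analysis only ([folklore]); NOT the stub; femto rung R2b1; NOT a claim about the gap.
-/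

set_option autoImplicit false

noncomputable section

open MeasureTheory Filter Topology Real
open Literature.Analysis.OperatorTheory.YMMatrixModel

namespace Summit.QuantumFields.YangMills.Theorems.FemtoTransferGap

section Pieces

/-- Energy of the smoothed remainder: `𝔮(P_{t/2} r) ≤ kacForm t r + 96 t ∫‖x‖² r² + 64 t² ∫ r²`
(reverse Poincaré H6b for the kinetic part, potential transfer at `s = t/2` for the potential part). [folklore] -/
theorem energyForm_heatSmooth_half_le {t : ℝ} (ht : 0 < t) {r : ZM → ℝ} {M : ℝ} (hrm : Measurable r)
    (hrb : ∀ x, |r x| ≤ M) (hri : Integrable r) (hrinv : IsGaugeInv r)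
    (hrw : Integrable fun x => (1 + ‖x‖ ^ 4) * r x ^ 2) (hrV : Integrable fun x => luscherPotential x * r x ^ 2) :
    energyForm (heatSmooth (t / 2) r) ≤
      kacForm t r + 96 * t * (∫ x, ‖x‖ ^ 2 * r x ^ 2) + 64 * t ^ 2 * ∫ x, r x ^ 2 := by
  have ht2 : 0 < t / 2 := half_pos ht
  have huK : IsKacFn (heatSmooth (t / 2) r) := isKacFn_heatSmooth ht2 hrm hrb hri hrinv hrw
  have hen : (1 / 2 : ℝ) * ∫ x, ‖gradient (heatSmooth (t / 2) r) x‖ ^ 2 ≤ flatJump t r :=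
    half_integral_norm_gradient_sq_heatSmooth_le_flatJump ht hrm hrb hri
  obtain ⟨-, hpot⟩ := integral_potential_mul_heatSmooth_sq_le ht2 hrm hrb hri hrw
  have hr2 : Integrable fun x => r x ^ 2 := integrable_sq_of_bounded_integrable hrm hrb hri
  have hx2 : Integrable fun x => ‖x‖ ^ 2 * r x ^ 2 := by
    refine hrw.mono' ((continuous_norm.pow 2).measurable.mul (hrm.pow_const 2)).aestronglyMeasurable
      (Eventually.of_forall fun x => ?_)
    rw [Real.norm_of_nonneg (mul_nonneg (sq_nonneg _) (sq_nonneg _))]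
    have : ‖x‖ ^ 2 ≤ 1 + ‖x‖ ^ 4 := by nlinarith [sq_nonneg (‖x‖ ^ 2 - 1)]
    exact mul_le_mul_of_nonneg_right this (sq_nonneg _)
  have e : ∫ x, (luscherPotential x + 192 * (t / 2) * ‖x‖ ^ 2 + 256 * (t / 2) ^ 2) * r x ^ 2 =
      (∫ x, luscherPotential x * r x ^ 2) + 96 * t * (∫ x, ‖x‖ ^ 2 * r x ^ 2) + 64 * t ^ 2 * ∫ x, r x ^ 2 := by
    have I12 : Integrable fun x => luscherPotential x * r x ^ 2 + 96 * t * (‖x‖ ^ 2 * r x ^ 2) := hrV.add (hx2.const_mul _)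
    rw [← integral_const_mul, ← integral_const_mul, ← integral_add hrV (hx2.const_mul _),
      ← integral_add I12 (hr2.const_mul _)]
    exact integral_congr_ae (Eventually.of_forall fun x => by ring)
  have hG : Integrable fun x => ‖gradient (heatSmooth (t / 2) r) x‖ ^ 2 := by
    refine (integrable_finsetSum Finset.univ fun p _ => huK.integrable_pderiv_sq p).congr (Eventually.of_forall fun x => ?_)
    show ∑ p, pderiv p (heatSmooth (t / 2) r) x ^ 2 = ‖gradient (heatSmooth (t / 2) r) x‖ ^ 2
    exact (norm_gradient_sq _ x).symm
  have hEu : energyForm (heatSmooth (t / 2) r) = (1 / 2 : ℝ) * (∫ x, ‖gradient (heatSmooth (t / 2) r) x‖ ^ 2) +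
      ∫ x, luscherPotential x * heatSmooth (t / 2) r x ^ 2 := by
    rw [energyForm, integral_add (hG.const_mul _) huK.integrable_potential_sq, integral_const_mul]
  rw [e] at hpot
  rw [hEu, kacForm]
  linarith [hen, hpot]

/-- The INSIDE/OUTSIDE split of the second moment of `r = g − F` for a datum `g` supported in `‖x‖ ≤ κ/√t`:
inside the ball `t‖x‖² ≤ κ²`, outside it `r = −F`; hence `t ∫‖x‖² r² ≤ κ² ∫ r² + t ∫ ‖x‖² F²`. [folklore] -/
theorem moment_split {t κ : ℝ} (ht : 0 < t) {g F : ZM → ℝ} (hsupp : ∀ x, g x ≠ 0 → ‖x‖ ≤ κ / Real.sqrt t)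
    (hr2 : Integrable fun x => (g - F) x ^ 2) (hx2 : Integrable fun x => ‖x‖ ^ 2 * (g - F) x ^ 2)
    (hF2 : Integrable fun x => ‖x‖ ^ 2 * F x ^ 2) :
    t * ∫ x, ‖x‖ ^ 2 * (g - F) x ^ 2 ≤ κ ^ 2 * (∫ x, (g - F) x ^ 2) + t * ∫ x, ‖x‖ ^ 2 * F x ^ 2 := by
  have hpt : ∀ x, t * (‖x‖ ^ 2 * (g - F) x ^ 2) ≤ κ ^ 2 * (g - F) x ^ 2 + t * (‖x‖ ^ 2 * F x ^ 2) := by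
    intro x
    by_cases hgx : g x = 0
    · have : (g - F) x = -F x := by simp [hgx]
      rw [this, neg_sq]
      nlinarith [mul_nonneg (sq_nonneg κ) (sq_nonneg (F x))]
    · have hxle := hsupp x hgx
      have hκ : 0 ≤ κ := by
        by_contra h
        have : κ / Real.sqrt t < 0 := div_neg_of_neg_of_pos (lt_of_not_ge h) (Real.sqrt_pos.2 ht)
        exact absurd (hxle.trans_lt this) (not_lt.2 (norm_nonneg x))
      have htx : t * ‖x‖ ^ 2 ≤ κ ^ 2 := by
        have hsq : ‖x‖ ^ 2 ≤ (κ / Real.sqrt t) ^ 2 := pow_le_pow_left₀ (norm_nonneg _) hxle 2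
        rw [div_pow, Real.sq_sqrt ht.le] at hsq
        calc t * ‖x‖ ^ 2 ≤ t * (κ ^ 2 / t) := mul_le_mul_of_nonneg_left hsq ht.le
          _ = κ ^ 2 := by field_simp
      nlinarith [sq_nonneg ((g - F) x), mul_nonneg ht.le (mul_nonneg (sq_nonneg ‖x‖) (sq_nonneg (F x))),
        mul_le_mul_of_nonneg_right htx (sq_nonneg ((g - F) x))]
  have hI : Integrable fun x => κ ^ 2 * (g - F) x ^ 2 + t * (‖x‖ ^ 2 * F x ^ 2) := (hr2.const_mul _).add (hF2.const_mul _)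
  have h := integral_mono (hx2.const_mul t) hI hpt
  rw [integral_const_mul, integral_add (hr2.const_mul _) (hF2.const_mul _), integral_const_mul, integral_const_mul] at h
  exact h

variable {m : ℕ} {f : Fin (m + 1) → ZM → ℝ} (hf : IsEigenFamily m f)
include hf

/-- Min–max for the smoothed remainder, in mass-defect form: if `Σ_j ⟨P_{t/2} r, f_j⟩² ≤ B` then
`physLevel (m+2) · (∫ r² − t·kacForm t r − B) ≤ 𝔮(P_{t/2} r)` (H3‴ with `‖P_{t/2}r‖² = ‖r‖² − t·flatJump t r`). [folklore] -/
theorem physLevel_mul_le_energyForm_heatSmooth {t : ℝ} (ht : 0 < t) {r : ZM → ℝ} {M : ℝ} (hrm : Measurable r)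
    (hrb : ∀ x, |r x| ≤ M) (hri : Integrable r) (hrinv : IsGaugeInv r)
    (hrw : Integrable fun x => (1 + ‖x‖ ^ 4) * r x ^ 2) {B : ℝ}
    (hB : ∑ j, (∫ x, heatSmooth (t / 2) r x * f j x) ^ 2 ≤ B) :
    physLevel (m + 2) * ((∫ x, r x ^ 2) - t * kacForm t r - B) ≤ energyForm (heatSmooth (t / 2) r) := by
  have huK : IsKacFn (heatSmooth (t / 2) r) := isKacFn_heatSmooth (half_pos ht) hrm hrb hri hrinv hrw
  have hH3 := physLevel_mul_sub_le_energyForm hf huK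
  have hmass : flatJump t r = (1 / t) * ((∫ x, r x ^ 2) - ∫ x, heatSmooth (t / 2) r x ^ 2) :=
    flatJump_eq_mass_defect ht hrm hrb hri
  have hl2u : l2sq (heatSmooth (t / 2) r) = (∫ x, r x ^ 2) - t * flatJump t r := by
    rw [l2sq, hmass]; field_simp; ring
  have hFJle : flatJump t r ≤ kacForm t r := flatJump_le_kacForm t r
  have h2 : (∫ x, r x ^ 2) - t * kacForm t r - B ≤
      l2sq (heatSmooth (t / 2) r) - ∑ j, (∫ x, heatSmooth (t / 2) r x * f j x) ^ 2 := by
    rw [hl2u]; nlinarith [mul_le_mul_of_nonneg_left hFJle ht.le]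
  exact (mul_le_mul_of_nonneg_left h2 (physLevel_nonneg (by omega))).trans hH3

omit hf in
/-- The arithmetic of III.10: the window inequality and the cancellation of `1 + E't`. [folklore] -/
theorem remainder_arith {E E' Θ κ t X S KC EU M₂ I : ℝ} (hE'0 : 0 ≤ E') (hX0 : 0 ≤ X)
    (hS0 : 0 ≤ S) (hM₂ : 0 ≤ M₂) (ht : 0 < t) (ht1 : t ≤ 1) (htd : t * (E' * Θ + 64 + (E + 2) * E' + 1) ≤ 1)
    (hgap : E + 96 * κ ^ 2 + 3 ≤ E') (hEU : EU ≤ KC + 96 * t * I + 64 * t ^ 2 * X)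
    (hmom : t * I ≤ κ ^ 2 * X + t * (M₂ * S)) (hlow : E' * (X - t * KC - t * Θ * X) ≤ EU) :
    (E + 2) * X - 96 * M₂ * t * S ≤ KC := by
  have hmain : (E' * (1 - t * Θ) - 96 * κ ^ 2 - 64 * t ^ 2) * X - 96 * t * (M₂ * S) ≤ KC * (1 + E' * t) := by
    nlinarith [hlow, hEU, hmom]
  have hwin : (E + 2) * (1 + E' * t) ≤ E' * (1 - t * Θ) - 96 * κ ^ 2 - 64 * t ^ 2 := by
    have h64 : 64 * t ^ 2 ≤ 64 * t := by nlinarith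
    nlinarith [hgap, htd, h64, ht.le]
  have h1Et : 0 < 1 + E' * t := by positivity
  have hB0 : 0 ≤ 96 * t * (M₂ * S) := by positivity
  have h2 : ((E + 2) * X - 96 * M₂ * t * S) * (1 + E' * t) ≤ KC * (1 + E' * t) := by
    nlinarith [hmain, mul_le_mul_of_nonneg_right hwin hX0, mul_nonneg hB0 (mul_nonneg hE'0 ht.le)]
  exact le_of_mul_le_mul_right h2 h1Et

/-- **III.10 — the high-mode bound for the remainder.**  Let `E ≥ 0`, `κ ≥ 0` with
`E + 96κ² + 3 ≤ physLevel (m+2)`.  There are `t₀ > 0` and `D₀ ≥ 0` (depending on the family, `E`, `κ`) such that for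
`0 < t ≤ t₀` and every datum `g` (measurable, bounded, colour-invariant, supported in `‖x‖ ≤ κ/√t`) with
`c_j = ⟨g, f_j⟩` and `r = g − Σ c_j f_j`:  `(E + 2) ∫ r² − D₀ t Σ c_j² ≤ kacForm t r`. [cite: SimonB1983DiscreteSpectrum, §3] -/
theorem kacForm_remainder_ge {E κ : ℝ} (hE : 0 ≤ E) (hgap : E + 96 * κ ^ 2 + 3 ≤ physLevel (m + 2)) :
    ∃ t₀ D₀ : ℝ, 0 < t₀ ∧ 0 ≤ D₀ ∧ ∀ t : ℝ, 0 < t → t ≤ t₀ → ∀ (g : ZM → ℝ) (M : ℝ) (c : Fin (m + 1) → ℝ),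
      Measurable g → (∀ x, |g x| ≤ M) → IsGaugeInv g → (∀ x, g x ≠ 0 → ‖x‖ ≤ κ / Real.sqrt t) →
      (∀ j, c j = ∫ x, g x * f j x) →
        (E + 2) * (∫ x, (g - eigSpan f c) x ^ 2) - D₀ * t * ∑ j, c j ^ 2 ≤ kacForm t (g - eigSpan f c) := by
  obtain ⟨Θ, hΘ0, hΘ⟩ := sum_sq_integral_heatSmooth_mul_le hf
  obtain ⟨M₂, hM₂0, hM₂⟩ := integral_norm_sq_mul_eigSpan_sq_le hf
  have hE'0 : 0 ≤ physLevel (m + 2) := physLevel_nonneg (by omega)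
  have hden : 0 < physLevel (m + 2) * Θ + 64 + (E + 2) * physLevel (m + 2) + 1 := by positivity
  refine ⟨min 1 (1 / (physLevel (m + 2) * Θ + 64 + (E + 2) * physLevel (m + 2) + 1)), 96 * M₂,
    lt_min one_pos (by positivity), by positivity, fun t ht htt₀ g M c hgm hgb hginv hsupp hc => ?_⟩
  have ht1 : t ≤ 1 := htt₀.trans (min_le_left _ _)
  have htd : t * (physLevel (m + 2) * Θ + 64 + (E + 2) * physLevel (m + 2) + 1) ≤ 1 := by
    have h := htt₀.trans (min_le_right _ _)
    rwa [le_div_iff₀ hden] at h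
  obtain ⟨hrm, ⟨M', hrb⟩, hri, hrinv, hrw, hrV, -, horth, -⟩ := remainder_package hf hgm hgb hsupp hginv c hc
  obtain ⟨hF2i, hF2le⟩ := hM₂ c
  have hr2 : Integrable fun x => (g - eigSpan f c) x ^ 2 := integrable_sq_of_bounded_integrable hrm hrb hri
  have hx2 : Integrable fun x => ‖x‖ ^ 2 * (g - eigSpan f c) x ^ 2 := by
    refine hrw.mono' ((continuous_norm.pow 2).measurable.mul (hrm.pow_const 2)).aestronglyMeasurable
      (Eventually.of_forall fun x => ?_)
    rw [Real.norm_of_nonneg (mul_nonneg (sq_nonneg _) (sq_nonneg _))]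
    have : ‖x‖ ^ 2 ≤ 1 + ‖x‖ ^ 4 := by nlinarith [sq_nonneg (‖x‖ ^ 2 - 1)]
    exact mul_le_mul_of_nonneg_right this (sq_nonneg _)
  have hEU := energyForm_heatSmooth_half_le ht hrm hrb hri hrinv hrw hrV
  have hmom := moment_split ht hsupp hr2 hx2 hF2i
  have hlow := physLevel_mul_le_energyForm_heatSmooth hf ht hrm hrb hri hrinv hrw (hΘ t ht _ hrm M' hrb hri horth)
  have hX0 : 0 ≤ ∫ x, (g - eigSpan f c) x ^ 2 := integral_nonneg fun x => sq_nonneg _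
  have hS0 : (0 : ℝ) ≤ ∑ j, c j ^ 2 := Finset.sum_nonneg fun j _ => sq_nonneg _
  have hmom' : t * ∫ x, ‖x‖ ^ 2 * (g - eigSpan f c) x ^ 2 ≤
      κ ^ 2 * (∫ x, (g - eigSpan f c) x ^ 2) + t * (M₂ * ∑ j, c j ^ 2) :=
    hmom.trans (by nlinarith [mul_le_mul_of_nonneg_left hF2le ht.le])
  exact remainder_arith hE'0 hX0 hS0 hM₂0 ht ht1 htd hgap hEU hmom' hlow

end Pieces

end Summit.QuantumFields.YangMills.Theorems.FemtoTransferGap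

end
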